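import Summits.ValiantsHypothesis.ValiantsHypothesis.Theorems.KPlusLogSqLawTropicalOrbitChainRules
import Summits.ValiantsHypothesis.ValiantsHypothesis.Theorems.LacunarySymmetroidMatrixDescartesCensusTropicalKLawSlopes

/-!
# Tropical census, symmetric `3 × 3` designs — an alternating ORBIT chain in RANK coordinates: the abstract hypotheses it satisfies

HONEST FRAMING.  Helper file (seat val-sym-lift-p2 (g6), cell `pub-symmetroid`, 2026-08-27; `--supports` the `WeakLifting` item
stmt-ValiantsHypothesis-19561 as a helper, no closure claim).  Pure lemma file: the INSTANTIATION LAYER of the port plan for the orbit row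
`TSymOrb34Le17` (blueprint `HOME/val-sym-lift-p2/g6/LEMMA-Z-liftp2g6.md` §6).  Given a chain of orbit-dominant terms of a symmetric `3 × 3`
design with `K` slope classes at strictly increasing integer slopes with alternating signs (the data of `TropRootLawAtSymmOrb 3 K B`), relabel
the classes by the SORTING BIJECTION `Tuple.sort d` of the exponents (rank `(Tuple.sort d).symm l`, exponents-by-rank `d ∘ Tuple.sort d`,
monotone).  This file proves, once, every hypothesis an abstract (rank-level, face-free) counting argument may use:
* `orbitChain_shape`  — every carrier is the identity, a transposition with equal RANKS on its pair, or fixed-point-free;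
* `orbitChain_M`      — columns of two chain terms reading the same cell (or transposed cells) carry non-decreasing ranks (`chain_M`);
* `orbitChain_S`      — exponent sums strictly increase (`chain_S` + `orbitChain_apart`), hence `orbitChain_injective` (distinct rank multisets);
* `orbitChain_R1` / `R1'` / `R3` / `R3'` / `R2` / `R2'` — the six crossing rules in `g`-form on ranks (`chain_R1` … `chain_R2'`).
So a future abstract core `∀ r g, (these hypotheses) → n ≤ B` yields `TropRootLawAtSymmOrb 3 K B` by one `refine`.  Nothing here is a census
numeral: tropical objects bound no real pencil; `TSymOrb34Le17` / `TSymOrb34Le16` stay targets (NOT asserted); ζ_sym(3,4) ∈ {18,19}, DoorA34 /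
DoorA26 (OPEN, typed, never asserted) untouched; nothing on `TropicalB` / `WeakLifting` as closed, `MatrixDescartes` (stmt-ValiantsHypothesis-18050)
or VP ≠ VNP.  [folklore] (bookkeeping over the tree's orbit rules)
-/

-- `Summit.ValiantsHypothesis.ValiantsHypothesis.…` is the tree's mandated single-conjunct layout (Sub = Summit).
set_option linter.dupNamespace false
set_option autoImplicit false

namespace Summit.ValiantsHypothesis.ValiantsHypothesis.Theorems.LacunarySymmetroidMatrixDescartes.TropicalCensus.Orbit

open Summit.ValiantsHypothesis.ValiantsHypothesis.Theorems.MatrixDescartes.Negative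
open Summit.ValiantsHypothesis.ValiantsHypothesis.Theorems.LacunarySymmetroidMatrixDescartes
open Summit.ValiantsHypothesis.ValiantsHypothesis.Theorems.LacunarySymmetroidMatrixDescartes.TropicalCensus
open Finset

variable {K : ℕ}

/-! ## The sorting bijection of the exponents -/

/-- exponents listed by rank are the exponents. [Tuple.sort] -/
theorem sort_symm_apply (d : Fin K → ℕ) (l : Fin K) : (d ∘ Tuple.sort d) ((Tuple.sort d).symm l) = d l := by
  simp

/-- a strictly smaller exponent has a strictly smaller rank. [Tuple.sort] -/
theorem rank_lt_of_d_lt (d : Fin K → ℕ) {l l' : Fin K} (h : d l < d l') : (Tuple.sort d).symm l < (Tuple.sort d).symm l' := by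
  by_contra hle
  push Not at hle
  have := Tuple.monotone_sort d hle
  rw [sort_symm_apply, sort_symm_apply] at this
  omega

/-- a smaller-or-equal letter (strictly smaller exponent, or the same class) has a smaller-or-equal rank. [Tuple.sort] -/
theorem rank_le_of_d_lt_or_eq (d : Fin K → ℕ) {l l' : Fin K} (h : l = l' ∨ d l < d l') :
    (Tuple.sort d).symm l ≤ (Tuple.sort d).symm l' := by
  rcases h with h | h
  · rw [h]
  · exact (rank_lt_of_d_lt d h).le

/-! ## The abstract hypotheses of an alternating orbit chain -/

section Chain

variable (d : Fin K → ℕ) (v ε : Fin 3 → Fin 3 → Fin K → ℤ) (hv : ∀ i j l, v i j l = v j i l) (hε : ∀ i j l, ε i j l = ε j i l)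
  {n : ℕ} (θ : Fin (n + 1) → ℤ) (p : Fin (n + 1) → Equiv.Perm (Fin 3) × (Fin 3 → Fin K))
  (hθ : StrictMono θ) (hdom : ∀ k, IsOrbitDominant d v ε (θ k) (p k))
  (halt : ∀ k : Fin n, termSign ε (p k.castSucc) * termSign ε (p k.succ) < 0)
include hv hε hθ hdom

omit hθ in
/-- **Shapes along the chain, rank form.** [isOrbitDominant_symm_three_shape] -/
theorem orbitChain_shape (k : Fin (n + 1)) :
    (p k).1 = 1 ∨ (∃ i j : Fin 3, i < j ∧ (p k).1 = Equiv.swap i j ∧ (Tuple.sort d).symm ((p k).2 i) = (Tuple.sort d).symm ((p k).2 j)) ∨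
      (∀ i, (p k).1 i ≠ i) := by
  rcases isOrbitDominant_symm_three_shape d v ε hv hε (p k).1 (p k).2 (hdom k) with h | ⟨i, j, hij, hs, hc⟩ | h
  · exact Or.inl h
  · exact Or.inr (Or.inl ⟨i, j, hij, hs, by rw [hc]⟩)
  · exact Or.inr (Or.inr h)

/-- **Rule M along the chain, rank form**: columns of two chain terms reading the same cell (or transposed cells) carry non-decreasing
ranks. [chain_M] -/
theorem orbitChain_M (a b : Fin (n + 1)) (hab : a < b) (l₁ l₂ : Fin 3)
    (hcell : ((p a).1 l₁ = (p b).1 l₂ ∧ l₁ = l₂) ∨ ((p a).1 l₁ = l₂ ∧ (p b).1 l₂ = l₁)) :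
    (Tuple.sort d).symm ((p a).2 l₁) ≤ (Tuple.sort d).symm ((p b).2 l₂) := by
  refine rank_le_of_d_lt_or_eq d ?_
  by_cases h : (p a).2 l₁ = (p b).2 l₂
  · exact Or.inl h
  · exact Or.inr (chain_M d v ε hv hε (hθ hab) (p a).1 (p b).1 (p a).2 (p b).2 l₁ l₂ hcell (hdom a) (hdom b) h)

include halt in
/-- **Rule S along the chain**: exponent sums strictly increase (different positions are different orbits). [chain_S, orbitChain_apart] -/
theorem orbitChain_S (a b : Fin (n + 1)) (hab : a < b) :
    TropicalCensus.slope d (p a) < TropicalCensus.slope d (p b) := by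
  obtain ⟨h1, h2⟩ := orbitChain_apart d v ε hv hε θ p hθ hdom halt hab
  exact chain_S d v ε (hθ hab) (p a) (p b) (hdom a) (hdom b) h1 h2

include halt in
/-- **Distinct rank multisets along the chain.** [orbitChain_S] -/
theorem orbitChain_injective :
    Function.Injective fun k => TropicalCensus.classSym (((p k).1, fun i => (Tuple.sort d).symm ((p k).2 i)) :
      Equiv.Perm (Fin 3) × (Fin 3 → Fin K)) := by
  have hslope : ∀ k, TropicalCensus.slope d (p k) =
      TropicalCensus.slope (d ∘ Tuple.sort d) ((p k).1, fun i => (Tuple.sort d).symm ((p k).2 i)) := by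
    intro k
    unfold TropicalCensus.slope
    simp only [sort_symm_apply]
  have key : ∀ a b : Fin (n + 1), a < b →
      TropicalCensus.classSym (((p a).1, fun i => (Tuple.sort d).symm ((p a).2 i)) : Equiv.Perm (Fin 3) × (Fin 3 → Fin K)) ≠
        TropicalCensus.classSym (((p b).1, fun i => (Tuple.sort d).symm ((p b).2 i)) : Equiv.Perm (Fin 3) × (Fin 3 → Fin K)) := by
    intro a b hlt heq
    have h1 := orbitChain_S d v ε hv hε θ p hθ hdom halt a b hlt
    rw [hslope, hslope, slope_eq_of_classSym, slope_eq_of_classSym, heq] at h1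
    exact lt_irrefl _ h1
  intro a b hab
  rcases lt_trichotomy a b with h | h | h
  · exact absurd hab (key a b h)
  · exact h
  · exact absurd hab.symm (key b a h)

omit hv hε in
/-- **Rule R1w along the chain, rank form**: identity term at `a`, transposition `swap i j` with equal ranks on its pair at `b > a` ⇒
`g(u i) + g(u j) < 2·g(b-rank)` for `g = d ∘ Tuple.sort d`. [chain_R1] -/
theorem orbitChain_R1 (a b : Fin (n + 1)) (hab : a < b) (ha1 : (p a).1 = 1) {i j : Fin 3} (hij : i ≠ j)
    (hb1 : (p b).1 = Equiv.swap i j) (hcc : (Tuple.sort d).symm ((p b).2 i) = (Tuple.sort d).symm ((p b).2 j)) :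
    (d ∘ Tuple.sort d) ((Tuple.sort d).symm ((p a).2 i)) + (d ∘ Tuple.sort d) ((Tuple.sort d).symm ((p a).2 j)) <
      2 * (d ∘ Tuple.sort d) ((Tuple.sort d).symm ((p b).2 i)) := by
  rw [sort_symm_apply, sort_symm_apply, sort_symm_apply]
  have hμ : (p b).2 i = (p b).2 j := (Tuple.sort d).symm.injective hcc
  have hD : IsOrbitDominant d v ε (θ a) (1, (p a).2) := by rw [← ha1]; exact hdom a
  have hT : IsOrbitDominant d v ε (θ b) (Equiv.swap i j, (p b).2) := by rw [← hb1]; exact hdom b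
  exact chain_R1 d v ε (hθ hab) hij (p a).2 (p b).2 hμ hD hT

omit hv hε in
/-- **Rule R1′w along the chain, rank form.** [chain_R1'] -/
theorem orbitChain_R1' (a b : Fin (n + 1)) (hab : a < b) (hb1 : (p b).1 = 1) {i j : Fin 3} (hij : i ≠ j)
    (ha1 : (p a).1 = Equiv.swap i j) (hcc : (Tuple.sort d).symm ((p a).2 i) = (Tuple.sort d).symm ((p a).2 j)) :
    2 * (d ∘ Tuple.sort d) ((Tuple.sort d).symm ((p a).2 i)) <
      (d ∘ Tuple.sort d) ((Tuple.sort d).symm ((p b).2 i)) + (d ∘ Tuple.sort d) ((Tuple.sort d).symm ((p b).2 j)) := by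
  rw [sort_symm_apply, sort_symm_apply, sort_symm_apply]
  have hμ : (p a).2 i = (p a).2 j := (Tuple.sort d).symm.injective hcc
  have hT : IsOrbitDominant d v ε (θ a) (Equiv.swap i j, (p a).2) := by rw [← ha1]; exact hdom a
  have hD : IsOrbitDominant d v ε (θ b) (1, (p b).2) := by rw [← hb1]; exact hdom b
  exact chain_R1' d v ε (hθ hab) hij (p b).2 (p a).2 hμ hT hD

/-- **Rule R3w along the chain, rank form**: identity term at `a`, pair carrier at `b > a` with carrier `i ↦ j ↦ k ↦ i` ⇒
`g(u i) + g(u j) < 2·g(rank of the {i,j}-letter)`. [chain_R3] -/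
theorem orbitChain_R3 (a b : Fin (n + 1)) (hab : a < b) (ha1 : (p a).1 = 1) {i j k : Fin 3} (hij : i ≠ j) (hki : k ≠ i) (hkj : k ≠ j)
    (hbi : (p b).1 i = j) (hbj : (p b).1 j = k) (hbk : (p b).1 k = i) :
    (d ∘ Tuple.sort d) ((Tuple.sort d).symm ((p a).2 i)) + (d ∘ Tuple.sort d) ((Tuple.sort d).symm ((p a).2 j)) <
      2 * (d ∘ Tuple.sort d) ((Tuple.sort d).symm ((p b).2 i)) := by
  rw [sort_symm_apply, sort_symm_apply, sort_symm_apply]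
  have hD : IsOrbitDominant d v ε (θ a) (1, (p a).2) := by rw [← ha1]; exact hdom a
  have h := chain_R3 hij hki hkj (p b).1 hbi hbj hbk d v ε hv hε (hθ hab) (p a).2 (p b).2 hD (hdom b)
  exact_mod_cast h

/-- **Rule R3′w along the chain, rank form.** [chain_R3'] -/
theorem orbitChain_R3' (a b : Fin (n + 1)) (hab : a < b) (hb1 : (p b).1 = 1) {i j k : Fin 3} (hij : i ≠ j) (hki : k ≠ i) (hkj : k ≠ j)
    (hai : (p a).1 i = j) (haj : (p a).1 j = k) (hak : (p a).1 k = i) :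
    2 * (d ∘ Tuple.sort d) ((Tuple.sort d).symm ((p a).2 i)) <
      (d ∘ Tuple.sort d) ((Tuple.sort d).symm ((p b).2 i)) + (d ∘ Tuple.sort d) ((Tuple.sort d).symm ((p b).2 j)) := by
  rw [sort_symm_apply, sort_symm_apply, sort_symm_apply]
  have hD : IsOrbitDominant d v ε (θ b) (1, (p b).2) := by rw [← hb1]; exact hdom b
  have h := chain_R3' hij hki hkj (p a).1 hai haj hak d v ε hv hε (hθ hab) (p b).2 (p a).2 (hdom a) hD
  exact_mod_cast h

/-- **Rule R2w along the chain, rank form**: transposition `swap i j` (equal ranks on the pair) at `a`, pair carrier `i ↦ j ↦ k ↦ i` at `b > a`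
⇒ `g(a-rank at k) + g(a-rank at i) < g(b-rank at j) + g(b-rank at k)`. [chain_R2] -/
theorem orbitChain_R2 (a b : Fin (n + 1)) (hab : a < b) {i j k : Fin 3} (hij : i ≠ j) (hki : k ≠ i) (hkj : k ≠ j)
    (ha1 : (p a).1 = Equiv.swap i j) (hcc : (Tuple.sort d).symm ((p a).2 i) = (Tuple.sort d).symm ((p a).2 j))
    (hbi : (p b).1 i = j) (hbj : (p b).1 j = k) (hbk : (p b).1 k = i) :
    (d ∘ Tuple.sort d) ((Tuple.sort d).symm ((p a).2 k)) + (d ∘ Tuple.sort d) ((Tuple.sort d).symm ((p a).2 i)) <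
      (d ∘ Tuple.sort d) ((Tuple.sort d).symm ((p b).2 j)) + (d ∘ Tuple.sort d) ((Tuple.sort d).symm ((p b).2 k)) := by
  rw [sort_symm_apply, sort_symm_apply, sort_symm_apply, sort_symm_apply]
  have hμ : (p a).2 i = (p a).2 j := (Tuple.sort d).symm.injective hcc
  have hT : IsOrbitDominant d v ε (θ a) (Equiv.swap i j, (p a).2) := by rw [← ha1]; exact hdom a
  have h := chain_R2 hij hki hkj (p b).1 hbi hbj hbk d v ε hv hε (hθ hab) (p a).2 (p b).2 hμ hT (hdom b)
  exact_mod_cast h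

/-- **Rule R2′w along the chain, rank form.** [chain_R2'] -/
theorem orbitChain_R2' (a b : Fin (n + 1)) (hab : a < b) {i j k : Fin 3} (hij : i ≠ j) (hki : k ≠ i) (hkj : k ≠ j)
    (hai : (p a).1 i = j) (haj : (p a).1 j = k) (hak : (p a).1 k = i)
    (hb1 : (p b).1 = Equiv.swap i j) (hcc : (Tuple.sort d).symm ((p b).2 i) = (Tuple.sort d).symm ((p b).2 j)) :
    (d ∘ Tuple.sort d) ((Tuple.sort d).symm ((p a).2 j)) + (d ∘ Tuple.sort d) ((Tuple.sort d).symm ((p a).2 k)) <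
      (d ∘ Tuple.sort d) ((Tuple.sort d).symm ((p b).2 k)) + (d ∘ Tuple.sort d) ((Tuple.sort d).symm ((p b).2 i)) := by
  rw [sort_symm_apply, sort_symm_apply, sort_symm_apply, sort_symm_apply]
  have hμ : (p b).2 i = (p b).2 j := (Tuple.sort d).symm.injective hcc
  have hT : IsOrbitDominant d v ε (θ b) (Equiv.swap i j, (p b).2) := by rw [← hb1]; exact hdom b
  have h := chain_R2' hij hki hkj (p a).1 hai haj hak d v ε hv hε (hθ hab) (p b).2 (p a).2 hμ (hdom a) hT
  exact_mod_cast h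

end Chain

end Summit.ValiantsHypothesis.ValiantsHypothesis.Theorems.LacunarySymmetroidMatrixDescartes.TropicalCensus.Orbit
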